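import Summits.Ventures.QEC.Census.CertCoverBatch
import Summits.Ventures.QEC.Census.BB.A1s_n192_k4_0fa3ae82.CoreDefs
import HarnessLib

set_option Elab.async false
set_option maxRecDepth 200000

/-!
# `[[192,4,18]]` one-level cover certificate — LEVEL-1→0 coset problems 0…10 (problem 1 excluded: `Prob1.lean`) as COMPACT data
(`ProbData`: U, f, σ, y₀, allow; qec-type-10 `CertCoverBatch.mkCoset` rebuilds each `CosetProb` in the kernel) + their verdict
`probsOK cov covR hx hx1 D1 lxd 16` (one `decide +kernel`). qec-search-9 g5 (lead block 170 (0)(c)); data from JSON `level10.problems`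
(sha256 08367568…). Data + decided check; KERNEL.
-/

namespace Summit.Ventures.QEC.Census.A1s_n192_k4_0fa3ae82

open Matrix Summit.Ventures.QEC.Census Literature.InformationTheory.QuantumCodes

/-- Problems 0…10 (10): `⟨U, f, σ, y₀, allow⟩`. -/
def probs00a : List ProbData := [
    ⟨99502504878023110, 0, 212205757136896, 72199431046561792, [0]⟩,
    ⟨144401078380794650, 1, 6597071470592, 144968460808893742, [1125899906842624, 288230376151711744]⟩,
    ⟨180988422909955072, 3, 0, 0, [0, 72057594037927936]⟩,
    ⟨289642149183488794, 2, 6597071470592, 1407374984217370, [0, 36894051097372524544, 73787539244791627776, 110680464442257309696]⟩,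
    ⟨326229528072657920, 1, 0, 0, [0, 72057594037927936, 144115188075855872]⟩,
    ⟨541839351643018240, 2, 0, 0, [0]⟩,
    ⟨580124359508894490, 0, 6597071470592, 1407374984217370, [0]⟩,
    ⟨687652168695579188, 0, 13194142941184, 111182620297036340, [0]⟩,
    ⟨832321561968423936, 0, 0, 0, [0]⟩,
    ⟨975310832957432832, 2, 0, 0, [0]⟩]

set_option maxHeartbeats 400000000 in
/-- Every problem of this chunk passes (`mkCoset` elimination + `cosetOKD` + fast `σ` + depth + `BU`-evenness + label checks). -/
theorem probs00a_ok : probsOK cov covR hx hx1 D1 lxd 16 probs00a = true := by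
  decide +kernel

/-- Pointwise form. -/
theorem probs00a_all : ∀ x ∈ probs00a, probOK cov covR hx hx1 D1 lxd 16 x = true := by
  have h := probs00a_ok
  rwa [probsOK, List.all_eq_true] at h

end Summit.Ventures.QEC.Census.A1s_n192_k4_0fa3ae82
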